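import Literature.AlgebraicGeometry.Resolution.PointBlowupResidueInequality
import HarnessLib

/-!
# The tangent cone decides the increase: Hauser–Perlega's characterisation (Comment (g)) of the
  increase of the shade for weighted homogeneous purely inseparable singularities, every `e`

Topic: `Literature/AlgebraicGeometry/Resolution`. Reproduction (cell `pub-hironaka`, unit
`b2b-hironaka-cp4`, DIM-4 CENSUS gen 16; sequel of `PointBlowupResidueInequality.lean`) of

* H. Hauser, S. Perlega, *Characterizing the increase of the residual order under blowup in
  positive characteristic*, Publ. RIMS **55** (2019) [HauserPerlega2019PRIMS], §3, **Comment (g)**: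
  "For fixed numbers `n`, `p`, `e` and `ℓ` as in the theorem, a homogeneous polynomial
  `F(x) = x^r·G(x)` of degree divisible by `pᵉ`, but not a `pᵉ`-th power, defines via
  `f = z^{pᵉ} + F(x)` a weighted homogeneous hypersurface singularity whose residual order
  increases under blowup if and only if `G(x)` is of the form specified in assertion (5) and the
  multiplicities `r_i` fulfill the arithmetic inequality in assertion (6) of the theorem", together
  with Comment (a): "The theorem only tells us something about the exceptional multiplicities and
  the (weighted) tangent cone of the ideal `J`."

## What is proved (every field `K` of characteristic `p` — indeed every natural `q` —, every finite
## index type `σ`, the model `PointBlowupShade.lean`; no cleanness hypothesis)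

For a state `s = (F, r)` whose residual polynomial `F ≠ 0` is HOMOGENEOUS of degree `o ≥ q` (so
`x^q + F` is weighted homogeneous and `F` is its own initial form), `y^r ∣ F`, and a point `b` of the
`y_j`-chart (`b_j = 0`), with `T = {j} ∪ {i : b_i ≠ 0}` and `Φ_{j,b}(F) = F(y_j ↦ 1, y_i ↦ y_i + b_i)`:

* `PointBlowup.shadeIncreases_of_forall_dvd_of_homogeneous` — if `q ∣ o` and every monomial of
  `Φ_{j,b}(F)` of degree `≤ o − Σ_{i∈T} r_i` has all its exponents divisible by `q` (assertion (4)
  in the model, equivalently the form (5) of `G`), then the shade INCREASES at `(j, b)`;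
* **`PointBlowup.shadeIncreases_iff_of_homogeneous`** — the increase at `(j, b)` is EQUIVALENT to
  "`q ∣ o` and (4)" (the "only if" being `dvd_of_shadeIncreases_of_mem_support_dehomog` and
  Probe 1); by `residueInequality_of_shadeIncreases` the residue inequality (6) then follows, so in the
  model "(5) and (6)" of Comment (g) reads "(4)", (6) being a consequence.

## What is NOT proved here (scope, honest)

* Non-homogeneous `F`: the higher-order terms can lower the new order below the threshold even when
  the tangent cone satisfies (4) (Comment (a)); for them only the necessary direction holds
  (`PointBlowupResidueInequality.lean`).
* Nothing here is a statement about resolution of singularities; census value only (row O5 of the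
  dimension-4 census of `pub-hironaka`: at the level of tangent cones the increase of the classical
  residual order at multiplicity `pᵉ` is exactly characterised, every `e`, every dimension).

AI-assisted formalisation (pub-hironaka cell); the informal gloss above is the cell's reading of
the cited pages, the Lean statements are what is certified.
-/

noncomputable section

open MvPolynomial Finset

open scoped BigOperators

namespace Literature.AlgebraicGeometry.Resolution

open Literature.AlgebraicGeometry.Resolution.Hauser2010
open Literature.Barriers.ResolutionOfSingularities

namespace PointBlowup

variable {σ : Type*} {K : Type*} [Field K] [Fintype σ] [DecidableEq σ] [DecidableEq K]

omit [Fintype σ] [DecidableEq σ] [DecidableEq K] in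
/-- A homogeneous polynomial is its own initial form. [folklore] -/
private theorem homogeneousComponent_eq_of_forall_degree_eq (F : MvPolynomial σ K) {o : ℕ}
    (hF : ∀ d ∈ F.support, d.degree = o) : homogeneousComponent o F = F := by
  ext d
  rw [coeff_homogeneousComponent]
  split_ifs with h
  · rfl
  · by_contra hne
    exact h (hF d (MvPolynomial.mem_support_iff.mpr (Ne.symm hne)))

omit [Fintype σ] [DecidableEq σ] [DecidableEq K] in
/-- The order of a non-zero homogeneous polynomial is its degree. [folklore] -/
private theorem ordZero_eq_of_forall_degree_eq (F : MvPolynomial σ K) (hF0 : F ≠ 0) {o : ℕ}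
    (hF : ∀ d ∈ F.support, d.degree = o) : ordZero F = o := by
  rw [ordZero_eq_nat_iff]
  obtain ⟨d, hd⟩ := MvPolynomial.ne_zero_iff.mp hF0
  refine ⟨⟨d, hd, hF d (MvPolynomial.mem_support_iff.mpr hd)⟩, fun d' hd' => ?_⟩
  by_contra hne
  have := hF d' (MvPolynomial.mem_support_iff.mpr hne)
  omega

/-- **Comment (g), "if": for a weighted homogeneous singularity, (4) forces the increase.** Let
`F ≠ 0` be homogeneous of degree `o ≥ q` with `q ∣ o`, `y^r ∣ F`, `b` a point of the `y_j`-chart.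
If every monomial `y^m` of `Φ_{j,b}(F)` with `|m| ≤ o − Σ_{i∈T} r_i` has all exponents divisible by
`q`, then the shade increases at `(j, b)`: every monomial of the translated chart transform lies in
the layer `E_j = o − q` (homogeneity), is `y_j^{o−q}·y^m` for a monomial `y^m` of `Φ_{j,b}(F)`,
and survives the cleaning only if `|m| > o − Σ_{i∈T} r_i`, i.e. `|E| > |r′| + shade`.
[cite: HauserPerlega2019PRIMS, §3 Comment (g)] -/
theorem shadeIncreases_of_forall_dvd_of_homogeneous (q : ℕ) (j : σ) (b : σ → K) (hbj : b j = 0)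
    (s : State σ K) (hF0 : s.F ≠ 0) {o : ℕ} (hF : ∀ d ∈ s.F.support, d.degree = o) (hqo : q ≤ o)
    (hqdvd : q ∣ o) (hr : ∀ d ∈ s.F.support, s.r ≤ d)
    (h4 : ∀ m ∈ (aeval (fun i => if i = j then (1 : MvPolynomial σ K) else X i + C (b i))
      s.F).support, m.degree + ∑ i ∈ lostComponents j b, s.r i ≤ o → ∀ i, q ∣ m i) :
    ShadeIncreases q j b s := by
  classical
  have ho : ordZero s.F = o := ordZero_eq_of_forall_degree_eq s.F hF0 hF
  have hIn : homogeneousComponent o s.F = s.F := homogeneousComponent_eq_of_forall_degree_eq s.F hF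
  have hthr := degree_newMult_add_sum_lost q j b hbj s ho
  obtain ⟨d₀, hd₀⟩ := MvPolynomial.ne_zero_iff.mp hF0
  have hd₀s : d₀ ∈ s.F.support := MvPolynomial.mem_support_iff.mpr hd₀
  have hro : s.r.degree ≤ o := (hF d₀ hd₀s) ▸ degree_le_degree_of_le (hr d₀ hd₀s)
  have hsum : ∑ i ∈ lostComponents j b, s.r i ≤ s.r.degree := by
    rw [Finsupp.degree_eq_sum]
    exact Finset.sum_le_sum_of_subset_of_nonneg (Finset.subset_univ _) fun _ _ _ => Nat.zero_le _
  -- every monomial of the new residual polynomial has degree `> θ = |r′| + shade`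
  have hbig : ∀ E ∈ (step q j b s).F.support,
      (newMult q j b s).degree + (o - s.r.degree) < E.degree := by
    intro E hE
    have hE' : coeff E (deletePthPowers q (pointTransform q j b s)) ≠ 0 :=
      MvPolynomial.mem_support_iff.mp hE
    rw [coeff_deletePthPowers] at hE'
    by_cases hpth : IsPthPowerExponent q E
    · exact absurd (if_pos hpth) hE'
    rw [if_neg hpth] at hE'
    -- `E_j = o − q`: `E` lies below the chart exponent of some monomial of `F`, all of degree `o`
    have hEsupp : E ∈ (pointTransform q j b s).support := MvPolynomial.mem_support_iff.mpr hE'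
    have hEj : E j = o - q := by
      rw [pointTransform_eq_sum] at hEsupp
      obtain ⟨d, hd, hEd⟩ := Finset.mem_biUnion.mp (MvPolynomial.support_sum hEsupp)
      have h1 := apply_eq_of_coeff_translate_monomial_ne_zero b hbj (MvPolynomial.mem_support_iff.mp hEd)
      rw [chartExponent_apply, if_pos rfl, hF d hd] at h1
      exact h1
    -- the corresponding monomial of `Φ_{j,b}(F)`
    have hm : E.erase j ∈ (aeval (fun i => if i = j then (1 : MvPolynomial σ K) else X i + C (b i))
        s.F).support := by
      rw [MvPolynomial.mem_support_iff, ← hIn, ← coeff_pointTransform_of_apply_eq q j b hbj s ho hqo hEj]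
      exact hE'
    have herase : (E.erase j).degree + E j = E.degree := by
      conv_rhs => rw [← Finsupp.erase_add_single j E]
      rw [map_add, Finsupp.degree_single]
    by_contra hle
    rw [not_lt] at hle
    apply hpth
    rw [isPthPowerExponent_iff]
    have hdvd := h4 _ hm (by omega)
    intro i
    by_cases hij : i = j
    · rw [hij, hEj]; exact Nat.dvd_sub hqdvd dvd_rfl
    · have := hdvd i
      rwa [Finsupp.erase_apply, if_neg hij] at this
  -- conclude
  unfold ShadeIncreases
  rw [shade_eq_of_ordZero_eq s ho]
  unfold State.shade
  by_cases hF1 : (step q j b s).F = 0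
  · rw [hF1, ordZero_zero, ENat.top_sub_coe]
    exact WithTop.coe_lt_top _
  · have hne : ordZero (step q j b s).F ≠ ⊤ := by
      unfold ordZero
      rw [Ne, MvPowerSeries.order_eq_top_iff, MvPolynomial.coe_eq_zero_iff]
      exact hF1
    obtain ⟨o₁, ho₁'⟩ := WithTop.ne_top_iff_exists.mp hne
    have ho₁ : ordZero (step q j b s).F = o₁ := ho₁'.symm
    obtain ⟨⟨E₁, hE₁, hE₁deg⟩, -⟩ := (ordZero_eq_nat_iff _ _).mp ho₁
    have h1 := hbig E₁ (MvPolynomial.mem_support_iff.mpr hE₁)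
    rw [hE₁deg] at h1
    rw [ho₁]
    show ((o - s.r.degree : ℕ) : ℕ∞) < (o₁ : ℕ∞) - ((step q j b s).r.degree : ℕ∞)
    rw [← ENat.coe_sub]
    have : o - s.r.degree < o₁ - (step q j b s).r.degree := by
      show o - s.r.degree < o₁ - (newMult q j b s).degree
      omega
    exact_mod_cast this

/-- **[HP19 PRIMS] Comment (g): for weighted homogeneous purely inseparable singularities the tangent
cone decides the increase.** Let `F ≠ 0` be homogeneous of degree `o ≥ q`, `y^r ∣ F`, `b` a point of
the `y_j`-chart. The shade increases at `(j, b)` IF AND ONLY IF `q ∣ o` and every monomial of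
`Φ_{j,b}(F)` of degree `≤ o − Σ_{i∈T} r_i` is a `q`-th-power exponent (assertion (4); the residue
inequality (6) then follows, `residueInequality_of_shadeIncreases`). "… increases under blowup if and
only if `G(x)` is of the form specified in assertion (5) and the multiplicities `r_i` fulfill the
arithmetic inequality in assertion (6)". [cite: HauserPerlega2019PRIMS, §3 Comment (g)] -/
theorem shadeIncreases_iff_of_homogeneous (q : ℕ) (j : σ) (b : σ → K) (hbj : b j = 0)
    (s : State σ K) (hF0 : s.F ≠ 0) {o : ℕ} (hF : ∀ d ∈ s.F.support, d.degree = o) (hqo : q ≤ o)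
    (hr : ∀ d ∈ s.F.support, s.r ≤ d) :
    ShadeIncreases q j b s ↔ q ∣ o ∧
      ∀ m ∈ (aeval (fun i => if i = j then (1 : MvPolynomial σ K) else X i + C (b i)) s.F).support,
        m.degree + ∑ i ∈ lostComponents j b, s.r i ≤ o → ∀ i, q ∣ m i := by
  have ho : ordZero s.F = o := ordZero_eq_of_forall_degree_eq s.F hF0 hF
  have hIn : homogeneousComponent o s.F = s.F := homogeneousComponent_eq_of_forall_degree_eq s.F hF
  constructor
  · intro hinc
    refine ⟨?_, fun m hm hdeg => ?_⟩
    · by_contra hndvd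
      exact absurd hinc (not_lt.mpr (shade_step_le_of_not_dvd q j b hbj s ho hqo hr hndvd))
    · refine dvd_of_shadeIncreases_of_mem_support_dehomog q j b hbj s ho hqo hr hinc ?_ hdeg
      rw [hIn]; exact hm
  · rintro ⟨hqdvd, h4⟩
    exact shadeIncreases_of_forall_dvd_of_homogeneous q j b hbj s hF0 hF hqo hqdvd hr h4

end PointBlowup

end Literature.AlgebraicGeometry.Resolution

end
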